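import Literature.IUT.LogThetaLattice.ArchMonoAnalyticLogShellSigns
import Literature.IUT.LogThetaLattice.BiCores
import Literature.IUT.LogThetaLattice.BiCoresOfKits
import Literature.IUT.LogThetaLattice.HolomorphicLogShellUnramified
import Literature.IUT.LogThetaLattice.HolomorphicLogShellVolume
import Literature.IUT.LogThetaLattice.HolomorphicLogShells

/-!
# Kernel DAG index — layer X = MIXED delta (L6 ×2; one file per cycle under the live-queue discipline), RE-KEY part b (GENERATED by abc-iut-c312-2 gen 4 `work/gen_index.py` @2026-08-26T07:15Z from HOME/plan/DAG.tsv +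
KERNEL-DAG-MODULES.tsv (regenerated 2026-08-26T07:01:05Z): 2 landed/discharged nodes NOT YET in the tree index Summits/ABC/IUTFork/DAG*.lean; spec v1.3 §2 (M))

THIS FILE PROVES NOTHING NEW AND ASSERTS NOTHING (HOME/plan/KERNEL-DAG-SPEC.md). It gives ONE NAME `N_<kernel_id>` to each DAG node whose
statement has LANDED through the gate, knitting the landed declarations BY NAME: claim nodes `N_<id> : Prop := StatementOf @thm₁ ∧ …` (one
conjunct per landed theorem the DAG row names, universe levels instantiated explicitly per the spec's UNIVERSE RULE, arities read off the farm),
witnessed `N_<id>_holds` iff the DAG row is `discharged(p…)` and `N_<id>_part` otherwise (spec §2(b),(c); c312-2 F1/F2); data nodes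
`abbrev N_<id> := @<primary>` with the row's further declarations as `example := @…` lines; FACT-style `def … : Prop` declarations are data
here (a NAME, never asserted). Decl lists come from the `decls` column of plan/DAG.tsv as resolved against the tree sources (unresolvable
tokens dropped and reported to abc-iut-dag on STATUS). Nothing here says abc is proved or refuted or takes a side on [IUTchIII] Cor 3.12.
typed ≠ discharged; indexed ≠ endorsed.
-/

namespace Summit.ABC.IUTFork.DAG

namespace PartRb
/-- `StatementOf h` is the statement (a `Prop`) of which the landed `h` is the proof: the index NAMES statements, it never re-types them. -/
abbrev StatementOf {P : Prop} (_h : P) : Prop := P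
end PartRb
open PartRb

noncomputable section
universe u₁ u₂ u₃ u₄ u₅ u₆ u₇ u₈ u₉ u₁₀ u₁₁ u₁₂ u₁₃ u₁₄ u₁₅ u₁₆


/-- [node IUTchIII:Prop1.2(vi) · L6/D3 · [IUTchIII] Prop 1.2 (vi), kurims p.30 · p406453 · claim · DAG status discharged(p406453)] decls 7 · CORRECTED SIBLING of the mis-resolved landed alias `N_IUTchIII_Prop1_2_vi` (append-only re-key; dag: kernel_id := `N_IUTchIII_Prop1_2_vi'`) · cites→ IUTchIII:Cor5.10,IUTchIII:Def1.1,IUTchIII:Prop5.7,IUTchIII:Rmk1.2.1 -/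
def N_IUTchIII_Prop1_2_vi' : Prop :=
  StatementOf @Literature.IUT.LogThetaLattice.BiCoricData.monoHolAt_subset_orbit.{u₁} ∧
  StatementOf @Literature.IUT.LogThetaLattice.BiCoricKit.liftPoly_monoFxm_map.{u₁} ∧
  StatementOf @Literature.IUT.LogThetaLattice.BiCoricData.ofKits_mem_monoFxm_iff.{u₁} ∧
  StatementOf @Literature.IUT.LogThetaLattice.localLogVolume_logShell_ofUnitLog_of_absRamificationIdx_le.{u₁} ∧
  StatementOf @Literature.IUT.LogThetaLattice.localLogVolume_logShell_ofUnitLog_eq.{u₁} ∧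
  StatementOf @Literature.IUT.LogThetaLattice.holMonoVolumeCompatible_ofUnitLog.{u₁}
/-- discharge of `N_IUTchIII_Prop1_2_vi'`: the landed theorems it names, BY NAME (spec §2(c)); proves nothing new. -/
theorem N_IUTchIII_Prop1_2_vi'_holds : N_IUTchIII_Prop1_2_vi' := ⟨@Literature.IUT.LogThetaLattice.BiCoricData.monoHolAt_subset_orbit, @Literature.IUT.LogThetaLattice.BiCoricKit.liftPoly_monoFxm_map, @Literature.IUT.LogThetaLattice.BiCoricData.ofKits_mem_monoFxm_iff, @Literature.IUT.LogThetaLattice.localLogVolume_logShell_ofUnitLog_of_absRamificationIdx_le, @Literature.IUT.LogThetaLattice.localLogVolume_logShell_ofUnitLog_eq, @Literature.IUT.LogThetaLattice.holMonoVolumeCompatible_ofUnitLog⟩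
example := @Literature.IUT.LogThetaLattice.HolMonoVolumeCompatible.{u₁}

/-- [node IUTchIII:Prop1.2(vii) · L6/D3 · [IUTchIII] Prop 1.2 (vii), kurims p.30 · p406839 · claim · DAG status discharged(p406839)] decls 9 · CORRECTED SIBLING of the mis-resolved landed alias `N_IUTchIII_Prop1_2_vii` (append-only re-key; dag: kernel_id := `N_IUTchIII_Prop1_2_vii'`) · cites→ IUTchIII:Cor5.10,IUTchIII:Def1.1,IUTchIII:Prop5.7,IUTchIII:Rmk1.2.1 · unresolved tokens dropped: Literature.IUT.LogThetaLattice.prop12vii_signMap_angLogV -/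
def N_IUTchIII_Prop1_2_vii' : Prop :=
  StatementOf @Literature.IUT.LogThetaLattice.prop12vii_intUnits_cast_sq ∧
  StatementOf @Literature.IUT.LogThetaLattice.prop12vii_units_smul_smul.{u₁} ∧
  StatementOf @Literature.IUT.LogThetaLattice.prop12vii_signMap_comp.{u₁} ∧
  StatementOf @Literature.IUT.LogThetaLattice.prop12vii_signMap_one.{u₁} ∧
  StatementOf @Literature.IUT.LogThetaLattice.prop12vii_signMap_involutive.{u₁} ∧
  StatementOf @Literature.IUT.LogThetaLattice.prop12vii_signMap_image_logShell.{u₁} ∧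
  StatementOf @Literature.IUT.LogThetaLattice.prop12vii_signMap_image_units.{u₁} ∧
  StatementOf @Literature.IUT.LogThetaLattice.prop12vii_sign_image_coreSeg.{u₁} ∧
  StatementOf @Literature.IUT.LogThetaLattice.prop12vii_signMap_radLogVol_logShell.{u₁}
/-- discharge of `N_IUTchIII_Prop1_2_vii'`: the landed theorems it names, BY NAME (spec §2(c)); proves nothing new. -/
theorem N_IUTchIII_Prop1_2_vii'_holds : N_IUTchIII_Prop1_2_vii' := ⟨@Literature.IUT.LogThetaLattice.prop12vii_intUnits_cast_sq, @Literature.IUT.LogThetaLattice.prop12vii_units_smul_smul, @Literature.IUT.LogThetaLattice.prop12vii_signMap_comp, @Literature.IUT.LogThetaLattice.prop12vii_signMap_one, @Literature.IUT.LogThetaLattice.prop12vii_signMap_involutive, @Literature.IUT.LogThetaLattice.prop12vii_signMap_image_logShell, @Literature.IUT.LogThetaLattice.prop12vii_signMap_image_units, @Literature.IUT.LogThetaLattice.prop12vii_sign_image_coreSeg, @Literature.IUT.LogThetaLattice.prop12vii_signMap_radLogVol_logShell⟩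

end

end Summit.ABC.IUTFork.DAG
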